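import Mathlib.Analysis.SpecialFunctions.Log.Deriv
import Mathlib.Analysis.Calculus.Deriv.MeanValue
import Mathlib.Topology.Order.Monotone
import HarnessLib

/-!
# The full sextic isolation SYSTEM `(Q6)` is preserved by pendant extension of the port — the non-port components

Support file for crux `stmt-CriticalPhenomena-4575` (`NoHeavyLowerTail`), seat `prim-facecert` gen 19 (`--supports stmt-CriticalPhenomena-4575`).
Companion of `…ThreePointIsoSexticPendant` (port component) and `…ThreePointIsoSexticPendantGraph`.  Lead memos
`run/shared/lean/prim/prim-l12/FROM-prim-nh-lead-4575-g115-Q6-LAW-ALGEBRA.md` §5–6 and `…-g117-NONPORT-Q6.md` (Lemma A, CLAIM, (★)).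

Law of `(a,b;h)`: `x,s,t,u,q ≥ 0`, sum `1`; `Q = q`, `I_a = q+u`, `I_b = q+t`, `I_h = q+s`, `z = q+t+u = P(a≁b)`.  The `(Q6)` SYSTEM is
`Q⁶ ≤ I_a²I_b³I_h³ ∧ Q⁶ ≤ I_a³I_b²I_h³ ∧ Q⁶ ≤ I_a³I_b³I_h²` (equivalently `Q⁶·max(I_a,I_b,I_h) ≤ (I_aI_bI_h)³`).  Arm/pendant extension of the port
with connection probability `α`: `Q' = αq+(1−α)z`, `I_a' = α(q+u)+(1−α)z`, `I_b' = α(q+t)+(1−α)z`, `I_w' = α(q+s)+1−α`.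

This file: the normalised LEMMA A (`lemmaA_log`) behind the `I_a`-component (lead g117): with `a = t/z`, `b = u/z`, `c = 1−q−s`, `d = a+b`,
`E(p) = (1−pa)²(1−pb)³(1−pc)³/(1−pd)⁶`, `M = (1−c)/(1−d)`:  `λ ≤ min(0, log M, log E(1)) ⟹ λ ≤ log E(p)` for `p ∈ [0,1]`
(applied with `λ = log z` in `…ThreePointIsoSexticPendantSystem`, which derives the law-level statements
`q⁶ ≤ (q+u)²(q+t)³(q+s)³ ⟹ Q'⁶ ≤ I_a'²·I_b'³·I_w'³` etc.).
PROOF (new reduction, this file).  Write `E = K·M_p`, `K(p) = (1−pa)²(1−pb)³(1−pc)²/(1−pd)⁵`, `M_p = (1−pc)/(1−pd) ≥ M` (`c ≥ d`).  (i) `K(p) ≥ 1 ⟹ E(p) ≥ M`.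
(ii) `K(p) < 1 ⟹ (log E)'(p) < 0` (`logE_deriv_neg`): in the variables `P = 1−pa, Q = 1−pb, C = 1−pc, D = P+Q−1 = 1−pd` the sign condition
`(log E)' ≥ 0` reads `2/P + 3/Q + 3/C ≤ 6/D + 2`, which forces `C ≥ 3/T`, `T = 6/D+2−2/P−3/Q`, and then `P²Q³C² ≥ D⁵` (`dagger`) because
`9P⁴Q⁵ − D³((6+2D)PQ − 2DQ − 3DP)² = (1−P)·Ψ₁ ≥ 0` on the triangle `P,Q ≤ 1 ≤ P+Q` — `Ψ₁` has the 25-term NONNEGATIVE INTEGER Bernstein expansion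
`psi_identity` in `(1−P, 1−Q, P+Q−1)` (degree 8; found with prim-facecert's certificate pipeline, `code/gen19/psi1_bern.py`).  (iii) Continuation: on an
interval where `K < 1`, `log E` is antitone (`antitoneOn_of_deriv_nonpos`); starting from `p` with `K(p) < 1`, either `K < 1` up to `1` (then
`E(p) ≥ E(1)`) or the first point `p₂ = sInf{K ≥ 1}` gives `E(p) ≥ E(p₂) ≥ M`.  The case `c ≤ d` is direct (`E ≥ 1`).  No sorries, standard axioms.
-/

namespace Summit.CriticalPhenomena.PercolationContinuityZ3.Theorems.ThreePointIsoSexticPendantNonPort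

open Set Real

/-! ## 1. The polynomial certificate and the inequality `(†)` -/

/-- Bernstein certificate: `9P⁴Q⁵ − (P+Q−1)³((6+2(P+Q−1))PQ − 2(P+Q−1)Q − 3(P+Q−1)P)²` is a nonnegative integer combination of
products `(1−P)^i (1−Q)^j (P+Q−1)^k` (25 terms, degree 9). [this work] -/
theorem psi_identity (P Q : ℝ) :
    9 * P ^ 4 * Q ^ 5 - (P + Q - 1) ^ 3 * ((6 + 2 * (P + Q - 1)) * P * Q - 2 * (P + Q - 1) * Q - 3 * (P + Q - 1) * P) ^ 2 =
      3 * (1 - P) ^ 1 * (P + Q - 1) ^ 8 +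
      6 * (1 - P) ^ 1 * (1 - Q) ^ 1 * (P + Q - 1) ^ 7 +
      12 * (1 - P) ^ 1 * (1 - Q) ^ 2 * (P + Q - 1) ^ 6 +
      18 * (1 - P) ^ 1 * (1 - Q) ^ 3 * (P + Q - 1) ^ 5 +
      9 * (1 - P) ^ 1 * (1 - Q) ^ 4 * (P + Q - 1) ^ 4 +
      17 * (1 - P) ^ 2 * (P + Q - 1) ^ 7 +
      66 * (1 - P) ^ 2 * (1 - Q) ^ 1 * (P + Q - 1) ^ 6 +
      135 * (1 - P) ^ 2 * (1 - Q) ^ 2 * (P + Q - 1) ^ 5 +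
      144 * (1 - P) ^ 2 * (1 - Q) ^ 3 * (P + Q - 1) ^ 4 +
      54 * (1 - P) ^ 2 * (1 - Q) ^ 4 * (P + Q - 1) ^ 3 +
      34 * (1 - P) ^ 3 * (P + Q - 1) ^ 6 +
      156 * (1 - P) ^ 3 * (1 - Q) ^ 1 * (P + Q - 1) ^ 5 +
      312 * (1 - P) ^ 3 * (1 - Q) ^ 2 * (P + Q - 1) ^ 4 +
      288 * (1 - P) ^ 3 * (1 - Q) ^ 3 * (P + Q - 1) ^ 3 +
      90 * (1 - P) ^ 3 * (1 - Q) ^ 4 * (P + Q - 1) ^ 2 +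
      29 * (1 - P) ^ 4 * (P + Q - 1) ^ 5 +
      132 * (1 - P) ^ 4 * (1 - Q) ^ 1 * (P + Q - 1) ^ 4 +
      234 * (1 - P) ^ 4 * (1 - Q) ^ 2 * (P + Q - 1) ^ 3 +
      180 * (1 - P) ^ 4 * (1 - Q) ^ 3 * (P + Q - 1) ^ 2 +
      45 * (1 - P) ^ 4 * (1 - Q) ^ 4 * (P + Q - 1) ^ 1 +
      9 * (1 - P) ^ 5 * (P + Q - 1) ^ 4 +
      36 * (1 - P) ^ 5 * (1 - Q) ^ 1 * (P + Q - 1) ^ 3 +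
      54 * (1 - P) ^ 5 * (1 - Q) ^ 2 * (P + Q - 1) ^ 2 +
      36 * (1 - P) ^ 5 * (1 - Q) ^ 3 * (P + Q - 1) ^ 1 +
      9 * (1 - P) ^ 5 * (1 - Q) ^ 4 := by
  ring

/-- `Ψ(P,Q) = 9P⁴Q⁵ − D³((6+2D)PQ − 2DQ − 3DP)² ≥ 0` on the triangle `P ≤ 1, Q ≤ 1, P + Q ≥ 1` (`D = P+Q−1`). [this work] -/
theorem psi_nonneg {P Q : ℝ} (hP : P ≤ 1) (hQ : Q ≤ 1) (hD : 1 ≤ P + Q) :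
    0 ≤ 9 * P ^ 4 * Q ^ 5 - (P + Q - 1) ^ 3 * ((6 + 2 * (P + Q - 1)) * P * Q - 2 * (P + Q - 1) * Q - 3 * (P + Q - 1) * P) ^ 2 := by
  rw [psi_identity]
  have hu : 0 ≤ 1 - P := by linarith
  have hv : 0 ≤ 1 - Q := by linarith
  have hw : 0 ≤ P + Q - 1 := by linarith
  positivity

/-- **`(†)`**: for `P, Q ∈ (0,1]`, `C > 0`, `D = P+Q−1 > 0`: `2/P + 3/Q + 3/C ≤ 6/D + 2 ⟹ D⁵ ≤ P²Q³C²`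
(the `p = 1` instance of "`(log E)' ≥ 0 ⟹ K ≥ 1`"; worst case `C = 3/T` reduces it to `psi_nonneg`). [this work] -/
theorem dagger {P Q C : ℝ} (hP0 : 0 < P) (hP1 : P ≤ 1) (hQ0 : 0 < Q) (hQ1 : Q ≤ 1) (hC0 : 0 < C) (hD : 0 < P + Q - 1)
    (hT : 2 / P + 3 / Q + 3 / C ≤ 6 / (P + Q - 1) + 2) : (P + Q - 1) ^ 5 ≤ P ^ 2 * Q ^ 3 * C ^ 2 := by
  set D := P + Q - 1 with hDdef
  set T := 6 / D + 2 - 2 / P - 3 / Q with hTdef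
  have h3C : 0 < 3 / C := by positivity
  have hT3 : 3 / C ≤ T := by rw [hTdef]; linarith
  have hTpos : 0 < T := lt_of_lt_of_le h3C hT3
  -- `C ≥ 3/T`
  have hC : 3 / T ≤ C := by
    rw [div_le_iff₀ hTpos]
    have := (div_le_iff₀ hC0).1 hT3
    linarith
  -- `9 P²Q³ ≥ D⁵ T²` from the certificate: `D·T·P·Q = (6+2D)PQ − 2DQ − 3DP`
  have hU : D * T * P * Q = (6 + 2 * D) * P * Q - 2 * D * Q - 3 * D * P := by
    rw [hTdef]; field_simp
  have hpsi := psi_nonneg hP1 hQ1 (by linarith : 1 ≤ P + Q)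
  rw [← hDdef, ← hU] at hpsi
  have hPQ : 0 < P ^ 2 * Q ^ 2 := by positivity
  have h9 : D ^ 5 * T ^ 2 ≤ 9 * P ^ 2 * Q ^ 3 := by
    -- `9P⁴Q⁵ − D³(DTPQ)² ≥ 0` divided by `P²Q²`
    have e : 9 * P ^ 4 * Q ^ 5 - D ^ 3 * (D * T * P * Q) ^ 2 = P ^ 2 * Q ^ 2 * (9 * P ^ 2 * Q ^ 3 - D ^ 5 * T ^ 2) := by ring
    rw [e] at hpsi
    have := (mul_nonneg_iff_of_pos_left hPQ).1 hpsi
    linarith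
  -- `C² ≥ 9/T²`
  have hC2 : 9 / T ^ 2 ≤ C ^ 2 := by
    have h0 : 0 ≤ 3 / T := by positivity
    calc 9 / T ^ 2 = (3 / T) ^ 2 := by rw [div_pow]; norm_num
      _ ≤ C ^ 2 := pow_le_pow_left₀ h0 hC 2
  have hT2 : 0 < T ^ 2 := by positivity
  calc D ^ 5 = D ^ 5 * T ^ 2 * (1 / T ^ 2) := by field_simp
    _ ≤ 9 * P ^ 2 * Q ^ 3 * (1 / T ^ 2) := mul_le_mul_of_nonneg_right h9 (by positivity)
    _ = P ^ 2 * Q ^ 3 * (9 / T ^ 2) := by ring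
    _ ≤ P ^ 2 * Q ^ 3 * C ^ 2 := mul_le_mul_of_nonneg_left hC2 (by positivity)

/-! ## 2. `K < 1 ⟹ (log E)' < 0` -/

/-- Derivative of `log E(p) = 2log(1−pa) + 3log(1−pb) + 3log(1−pc) − 6log(1−p(a+b))`. [this work] -/
theorem hasDerivAt_logE {a b c p : ℝ} (ha : 1 - p * a ≠ 0) (hb : 1 - p * b ≠ 0) (hc : 1 - p * c ≠ 0)
    (hd : 1 - p * (a + b) ≠ 0) :
    HasDerivAt (fun x => 2 * Real.log (1 - x * a) + 3 * Real.log (1 - x * b) + 3 * Real.log (1 - x * c) -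
        6 * Real.log (1 - x * (a + b)))
      (2 * (-a / (1 - p * a)) + 3 * (-b / (1 - p * b)) + 3 * (-c / (1 - p * c)) - 6 * (-(a + b) / (1 - p * (a + b)))) p := by
  have h1 : ∀ y : ℝ, 1 - p * y ≠ 0 → HasDerivAt (fun x => Real.log (1 - x * y)) (-y / (1 - p * y)) p := by
    intro y hy
    exact ((hasDerivAt_mul_const y).const_sub 1).log hy
  exact ((((h1 a ha).const_mul 2).add ((h1 b hb).const_mul 3)).add ((h1 c hc).const_mul 3)).sub ((h1 _ hd).const_mul 6)

/-- **(ii)** `K(p) < 1 ⟹ (log E)'(p) < 0`: for `p > 0` with `1−pa, 1−pb ∈ (0,1]`, `1−pc > 0`, `1−p(a+b) > 0`,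
`(1−pa)²(1−pb)³(1−pc)² < (1−p(a+b))⁵` forces the derivative of `log E` to be negative. [this work] -/
theorem logE_deriv_neg {a b c p : ℝ} (hp : 0 < p) (hPa0 : 0 < 1 - p * a) (hPa1 : 1 - p * a ≤ 1) (hPb0 : 0 < 1 - p * b)
    (hPb1 : 1 - p * b ≤ 1) (hPc : 0 < 1 - p * c) (hPd : 0 < 1 - p * (a + b))
    (hK : (1 - p * a) ^ 2 * (1 - p * b) ^ 3 * (1 - p * c) ^ 2 < (1 - p * (a + b)) ^ 5) :
    2 * (-a / (1 - p * a)) + 3 * (-b / (1 - p * b)) + 3 * (-c / (1 - p * c)) - 6 * (-(a + b) / (1 - p * (a + b))) < 0 := by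
  set P := 1 - p * a with hP
  set Q := 1 - p * b with hQ
  set C := 1 - p * c with hC
  have hDPQ : 1 - p * (a + b) = P + Q - 1 := by rw [hP, hQ]; ring
  rw [hDPQ] at hK hPd ⊢
  -- the derivative equals `−(1/p)·[(2/P + 3/Q + 3/C) − (6/D + 2)]`
  have ha' : a = (1 - P) / p := by rw [hP]; field_simp; ring
  have hb' : b = (1 - Q) / p := by rw [hQ]; field_simp; ring
  have hc' : c = (1 - C) / p := by rw [hC]; field_simp; ring
  have hPne : P ≠ 0 := ne_of_gt hPa0
  have hQne : Q ≠ 0 := ne_of_gt hPb0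
  have hCne : C ≠ 0 := ne_of_gt hPc
  have hDne : P + Q - 1 ≠ 0 := ne_of_gt hPd
  have hpne : p ≠ 0 := ne_of_gt hp
  have e : 2 * (-a / P) + 3 * (-b / Q) + 3 * (-c / C) - 6 * (-(a + b) / (P + Q - 1)) =
      -(1 / p) * ((2 / P + 3 / Q + 3 / C) - (6 / (P + Q - 1) + 2)) := by
    rw [ha', hb', hc']; field_simp; ring
  rw [e]
  have hlt : 6 / (P + Q - 1) + 2 < 2 / P + 3 / Q + 3 / C := by
    by_contra h
    push Not at h
    exact absurd (dagger hPa0 hPa1 hPb0 hPb1 hPc hPd h) (not_le.mpr hK)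
  have : 0 < (1 / p) * ((2 / P + 3 / Q + 3 / C) - (6 / (P + Q - 1) + 2)) := mul_pos (by positivity) (by linarith)
  linarith

/-! ## 3. LEMMA A (normalised, log form) -/

/-- **LEMMA A (log form).**  `a, b, c ∈ [0,1)`, `d = a+b < 1`, `p ∈ [0,1]`; `φ(x) = 2log(1−xa)+3log(1−xb)+3log(1−xc)−6log(1−xd)` (`= log E(x)`).
If `λ ≤ 0`, `λ ≤ log(1−c) − log(1−d)` and `λ ≤ φ(1)` then `λ ≤ φ(p)`; i.e. `E(p) ≥ min{1, (1−c)/(1−d), E(1)}`. [this work] -/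
theorem lemmaA_log {a b c p lam : ℝ} (ha : 0 ≤ a) (hb : 0 ≤ b) (hc : 0 ≤ c) (hd : a + b < 1) (hc1 : c < 1)
    (hp0 : 0 ≤ p) (hp1 : p ≤ 1) (hl0 : lam ≤ 0) (hlM : lam ≤ Real.log (1 - c) - Real.log (1 - (a + b)))
    (hl1 : lam ≤ 2 * Real.log (1 - 1 * a) + 3 * Real.log (1 - 1 * b) + 3 * Real.log (1 - 1 * c) -
      6 * Real.log (1 - 1 * (a + b))) :
    lam ≤ 2 * Real.log (1 - p * a) + 3 * Real.log (1 - p * b) + 3 * Real.log (1 - p * c) -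
      6 * Real.log (1 - p * (a + b)) := by
  set φ : ℝ → ℝ := fun x => 2 * Real.log (1 - x * a) + 3 * Real.log (1 - x * b) + 3 * Real.log (1 - x * c) -
      6 * Real.log (1 - x * (a + b)) with hφ
  -- positivity of the four factors on `[0,1]`
  have pos : ∀ {x y : ℝ}, 0 ≤ x → x ≤ 1 → 0 ≤ y → y < 1 → 0 < 1 - x * y := by
    intro x y hx0 hx1 hy0 hy1; nlinarith
  have le1 : ∀ {x y : ℝ}, 0 ≤ x → 0 ≤ y → 1 - x * y ≤ 1 := by
    intro x y hx hy; nlinarith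
  have ha1 : a < 1 := by linarith
  have hb1 : b < 1 := by linarith
  have hd0 : 0 ≤ a + b := by positivity
  show lam ≤ φ p
  -- monotone comparison `log(1−xc) − log(1−xd) ≥ log(1−c) − log(1−d)` for `c ≥ d`, `x ≤ 1`
  have cmp : ∀ {x : ℝ}, 0 ≤ x → x ≤ 1 → a + b ≤ c →
      Real.log (1 - c) - Real.log (1 - (a + b)) ≤ Real.log (1 - x * c) - Real.log (1 - x * (a + b)) := by
    intro x hx0 hx1 hcd
    have h1 : 0 < 1 - c := by linarith
    have h2 : 0 < 1 - (a + b) := by linarith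
    have h3 : 0 < 1 - x * c := pos hx0 hx1 hc hc1
    have h4 : 0 < 1 - x * (a + b) := pos hx0 hx1 hd0 hd
    rw [← Real.log_div h1.ne' h2.ne', ← Real.log_div h3.ne' h4.ne']
    apply Real.log_le_log (div_pos h1 h2)
    rw [div_le_div_iff₀ h2 h4]
    nlinarith
  -- `φ = ψ + (log(1−xc) − log(1−xd))`, `ψ = log K`
  have split : ∀ x, φ x = (2 * Real.log (1 - x * a) + 3 * Real.log (1 - x * b) + 2 * Real.log (1 - x * c) -
      5 * Real.log (1 - x * (a + b))) + (Real.log (1 - x * c) - Real.log (1 - x * (a + b))) := by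
    intro x; simp only [hφ]; ring
  -- `K(x) ≥ 1` in polynomial form gives `ψ x ≥ 0`
  have psi_nonneg_of : ∀ {x : ℝ}, 0 ≤ x → x ≤ 1 →
      (1 - x * (a + b)) ^ 5 ≤ (1 - x * a) ^ 2 * (1 - x * b) ^ 3 * (1 - x * c) ^ 2 →
      0 ≤ 2 * Real.log (1 - x * a) + 3 * Real.log (1 - x * b) + 2 * Real.log (1 - x * c) -
        5 * Real.log (1 - x * (a + b)) := by
    intro x hx0 hx1 hK
    have h1 := pos hx0 hx1 ha ha1
    have h2 := pos hx0 hx1 hb hb1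
    have h3 := pos hx0 hx1 hc hc1
    have h4 := pos hx0 hx1 hd0 hd
    have hlog := Real.log_le_log (pow_pos h4 5) hK
    rw [Real.log_mul (mul_ne_zero (pow_ne_zero _ h1.ne') (pow_ne_zero _ h2.ne')) (pow_ne_zero _ h3.ne'),
      Real.log_mul (pow_ne_zero _ h1.ne') (pow_ne_zero _ h2.ne'), Real.log_pow, Real.log_pow, Real.log_pow,
      Real.log_pow] at hlog
    push_cast at hlog
    linarith
  -- case `c ≤ d`: `E ≥ 1` directly
  rcases le_or_gt c (a + b) with hcd | hcd
  · have h1 := pos hp0 hp1 ha ha1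
    have h2 := pos hp0 hp1 hb hb1
    have h3 := pos hp0 hp1 hc hc1
    have h4 := pos hp0 hp1 hd0 hd
    have hpoly : (1 - p * (a + b)) ^ 6 ≤ (1 - p * a) ^ 2 * (1 - p * b) ^ 3 * (1 - p * c) ^ 3 := by
      have e1 : 1 - p * (a + b) ≤ (1 - p * a) * (1 - p * b) := by nlinarith [mul_nonneg ha hb, sq_nonneg p]
      have e2 : 1 - p * (a + b) ≤ 1 - p * b := by nlinarith
      have e3 : 1 - p * (a + b) ≤ 1 - p * c := by nlinarith
      have h4' := h4.le
      calc (1 - p * (a + b)) ^ 6 = (1 - p * (a + b)) ^ 2 * (1 - p * (a + b)) * (1 - p * (a + b)) ^ 3 := by ring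
        _ ≤ ((1 - p * a) * (1 - p * b)) ^ 2 * (1 - p * b) * (1 - p * c) ^ 3 := by
            apply mul_le_mul (mul_le_mul (pow_le_pow_left₀ h4' e1 2) e2 h4' (by positivity))
              (pow_le_pow_left₀ h4' e3 3) (by positivity) (by positivity)
        _ = (1 - p * a) ^ 2 * (1 - p * b) ^ 3 * (1 - p * c) ^ 3 := by ring
    have hlog := Real.log_le_log (pow_pos h4 6) hpoly
    rw [Real.log_mul (mul_ne_zero (pow_ne_zero _ h1.ne') (pow_ne_zero _ h2.ne')) (pow_ne_zero _ h3.ne'),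
      Real.log_mul (pow_ne_zero _ h1.ne') (pow_ne_zero _ h2.ne'), Real.log_pow, Real.log_pow, Real.log_pow,
      Real.log_pow] at hlog
    push_cast at hlog
    have : 0 ≤ φ p := by simp only [hφ]; linarith
    linarith
  -- case `c > d`
  have hφM : ∀ {x : ℝ}, 0 ≤ x → x ≤ 1 →
      (1 - x * (a + b)) ^ 5 ≤ (1 - x * a) ^ 2 * (1 - x * b) ^ 3 * (1 - x * c) ^ 2 → lam ≤ φ x := by
    intro x hx0 hx1 hK
    rw [split x]
    have := psi_nonneg_of hx0 hx1 hK
    have := cmp hx0 hx1 hcd.le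
    linarith
  by_cases hKp : (1 - p * (a + b)) ^ 5 ≤ (1 - p * a) ^ 2 * (1 - p * b) ^ 3 * (1 - p * c) ^ 2
  · exact hφM hp0 hp1 hKp
  -- `K(p) < 1`: continuation argument
  have hderiv : ∀ {x : ℝ}, 0 ≤ x → x ≤ 1 → HasDerivAt φ (2 * (-a / (1 - x * a)) + 3 * (-b / (1 - x * b)) +
      3 * (-c / (1 - x * c)) - 6 * (-(a + b) / (1 - x * (a + b)))) x := by
    intro x hx0 hx1
    exact hasDerivAt_logE (pos hx0 hx1 ha ha1).ne' (pos hx0 hx1 hb hb1).ne' (pos hx0 hx1 hc hc1).ne' (pos hx0 hx1 hd0 hd).ne'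
  -- antitone on `[p, q]` as soon as `K < 1` on `[p, q)`
  have anti : ∀ {q : ℝ}, p ≤ q → q ≤ 1 →
      (∀ x, p ≤ x → x < q → ¬ (1 - x * (a + b)) ^ 5 ≤ (1 - x * a) ^ 2 * (1 - x * b) ^ 3 * (1 - x * c) ^ 2) →
      φ q ≤ φ p := by
    intro q hpq hq1 hKlt
    have hanti : AntitoneOn φ (Icc p q) := by
      apply antitoneOn_of_deriv_nonpos (convex_Icc p q)
      · intro x hx
        exact (hderiv (hp0.trans hx.1) (hx.2.trans hq1)).continuousAt.continuousWithinAt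
      · intro x hx
        rw [interior_Icc] at hx
        exact (hderiv (hp0.trans hx.1.le) (hx.2.le.trans hq1)).differentiableAt.differentiableWithinAt
      · intro x hx
        rw [interior_Icc] at hx
        have hx0 : 0 ≤ x := hp0.trans hx.1.le
        have hx1 : x ≤ 1 := hx.2.le.trans hq1
        rw [(hderiv hx0 hx1).deriv]
        have hxpos : 0 < x := lt_of_le_of_lt hp0 hx.1
        exact (logE_deriv_neg hxpos (pos hx0 hx1 ha ha1) (le1 hx0 ha) (pos hx0 hx1 hb hb1) (le1 hx0 hb)
          (pos hx0 hx1 hc hc1) (pos hx0 hx1 hd0 hd) (lt_of_not_ge (hKlt x hx.1.le hx.2))).le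
    exact hanti (left_mem_Icc.2 hpq) (right_mem_Icc.2 hpq) hpq
  set S : Set ℝ := {x | x ∈ Icc p 1 ∧ (1 - x * (a + b)) ^ 5 ≤ (1 - x * a) ^ 2 * (1 - x * b) ^ 3 * (1 - x * c) ^ 2}
    with hS
  by_cases hne : S.Nonempty
  · have hclosed : IsClosed S := by
      rw [hS]
      exact isClosed_Icc.inter (isClosed_le (by fun_prop : Continuous fun x : ℝ => (1 - x * (a + b)) ^ 5)
        (by fun_prop : Continuous fun x : ℝ => (1 - x * a) ^ 2 * (1 - x * b) ^ 3 * (1 - x * c) ^ 2))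
    have hbdd : BddBelow S := ⟨p, fun x hx => hx.1.1⟩
    set p₂ := sInf S with hp₂
    have hmem : p₂ ∈ S := hclosed.csInf_mem hne hbdd
    have hp2 : p ≤ p₂ := le_csInf hne fun x hx => hx.1.1
    have hp21 : p₂ ≤ 1 := hmem.1.2
    have hbelow : ∀ x, p ≤ x → x < p₂ →
        ¬ (1 - x * (a + b)) ^ 5 ≤ (1 - x * a) ^ 2 * (1 - x * b) ^ 3 * (1 - x * c) ^ 2 := by
      intro x hx1 hx2 hK
      have hxS : x ∈ S := ⟨⟨hx1, hx2.le.trans hp21⟩, hK⟩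
      exact absurd (csInf_le hbdd hxS) (not_le.mpr hx2)
    calc lam ≤ φ p₂ := hφM (hp0.trans hp2) hp21 hmem.2
      _ ≤ φ p := anti hp2 hp21 hbelow
  · have hall : ∀ x, p ≤ x → x < 1 →
        ¬ (1 - x * (a + b)) ^ 5 ≤ (1 - x * a) ^ 2 * (1 - x * b) ^ 3 * (1 - x * c) ^ 2 := by
      intro x hx1 hx2 hK
      exact hne ⟨x, ⟨hx1, hx2.le⟩, hK⟩
    calc lam ≤ φ 1 := hl1
      _ ≤ φ p := anti hp1 le_rfl hall

end Summit.CriticalPhenomena.PercolationContinuityZ3.Theorems.ThreePointIsoSexticPendantNonPort
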